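import Literature.IUT.HodgeArakelov.ThetaSettingCompletionPackage
import Literature.IUT.HodgeArakelov.ThetaSettingDeltaCharacteristicGenuine
import Literature.AnabelianGeometry.AbsoluteAnabelian.AbsTopIThm26GeomCentralizerRouteFree
import HarnessLib

/-!
# (H1) «`Δ ⊆ Π` characteristic» for an [IUTchII] §1 setting from a CENTRALISING subgroup and a free
# profinite `Δ_E`: the «projectivity route» assembled at the named completion package

S. Mochizuki, *Inter-universal Teichmüller theory II*, §1, Example 1.8 (i) (kurims p. 35): "the subgroup `Δ ⊆ Π` [...]
may be characterized group-theoretically" [claim: Mochizuki2012, status: disputed]; [AbsTopI] Thm 2.6 (iv)/(v) p. 22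
[cite: MochizukiAbsTopI2012, Thm 2.6 (v) p.22]; [SemiAnbd] §6 p. 69 (profinite completions)
[cite: MochizukiSemiAnbd2006, §6 p.69].

Cell `abc-iut`, seat abc-iut-w4-d044 (gen 7), row W1 «MCHAR-VIA-PROJECTIVITY (ii-b)» (abc-iut-L6-lead §F v1.19ck;
co-custody abc-iut-L2-lead R565), file A = the GENERIC ASSEMBLY over any [IUTchII] §1 setting `S`.  PROOF-ONLY (no
definition, no instance, no named fact); consumes BY NAME: abc-iut-w5-d233's named completion package
(`ThetaSetting.completionPackage`, `geom_completionPackage_eq_topologicalClosure`, `completionAug_completionMap`,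
`isTopologicallyFinitelyGenerated_geom_completionPackage`), p429527's regime-free reduction
`ThetaSetting.deltaX_map_eq_of_completion_compatible`, abc-iut-w6-d055's route p473904 through this seat's
`FundamentalExtension.MLFBase.preservesGeom_of_centralizer_eq_bot` + `hprime_geom_of_mulEquiv_isOpen_freeProfinite`
(p481457: the classical input (H′) is a THEOREM), and `freeProlRank_of_isOpen_profiniteCompletion_freeGroup` /
`freeProlRank_eq_of_continuousMulEquiv` for the `δ¹`-balance.

WHAT IS SHOWN — `ThetaSetting.deltaX_characteristic_of_centralizer`: let `S` be an [IUTchII] §1 setting with an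
identification `eK : G_k ⥲ Gal(K̄/K)`, `K/ℚ_p` finite, and `E := S.completionPackage K eK` its named package.  IF
* `aug_S` is an open map and `Δ^{(S)}` is topologically finitely generated (then `Δ_E` = closure of `ι(Δ^{(S)})` is tfg);
* `Gal(K̄/K)` is slim;
* a subgroup `A₀ ≤ Π^{(S)}` CENTRALISES `Δ^{(S)}` and its image `aug_S(A₀)` meets every open subgroup of `G_k`
  non-trivially;
* `Δ_E` is, as a topological group, an OPEN subgroup `U` of a free profinite group `F̂_n`, `n ≥ 2`
  (`eΔ : Δ_E ≃ₜ* U` — the identification input),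
THEN every automorphism of topological groups of `Π^{(S)}` carries `Δ^{(S)}` onto itself.  No anabelian named fact, no
`CoinvariantRankConstant` (F-0001): `δ¹_ℓ(U) = (n−1)[F̂_n : U] + 1` for EVERY `ℓ` supplies the balance, `ι(A₀)` is the
centralising subgroup of the route, and (H′) for `Δ_E ≃ U` kills the commuting pair.
Helper: `ThetaSetting.map_completionMap_le_centralizer_geom` (`ι(A₀)` centralises `Δ_E`).

HONEST FRAMING: a theorem about OUR typed interface `ThetaSetting` and its named completion package; the identification
`eΔ` and the density clause on `aug_S(A₀)` are explicit binders (supplied, or carried, by the model-side file); not a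
verdict on (H1) at any genuine curve; nothing here bears on [IUTchIII] Cor. 3.12 or takes a side; typed ≠ proved
elsewhere; instantiated ≠ endorsed; nothing asserts abc proved or refuted.
-/

noncomputable section

namespace Literature.IUT.HodgeArakelov

open Literature.AnabelianGeometry.AbsoluteAnabelian
open Literature.AnabelianGeometry.SemiGraphs
open Literature.AlgebraicGeometry.Frobenioids (IsSlimGroup)
open Literature.IUT.HodgeTheaters (profiniteCompletion)

namespace ThetaSetting

variable (S : ThetaSetting.{0}) (K : Type) [Field K] [CharZero K] (eK : S.Gk ≃ₜ* Field.absoluteGaloisGroup K)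

/-- **`ι(A₀)` centralises `Δ_E`** when `A₀` centralises `Δ^{(S)}` and `aug_S` is open: `Δ_E` is the CLOSURE of
`ι(Δ^{(S)})` (`geom_completionPackage_eq_topologicalClosure`) and centralisers of elements are closed.
[cite: MochizukiSemiAnbd2006, §6 p.69] -/
theorem map_completionMap_le_centralizer_geom (hopen : IsOpenMap S.aug) (A₀ : Subgroup S.PiX)
    (hA₀ : A₀ ≤ Subgroup.centralizer ((S.DeltaX : Subgroup S.PiX) : Set S.PiX)) :
    A₀.map S.completionMap.toMonoidHom ≤
      Subgroup.centralizer (((S.completionPackage K eK).geom : Subgroup (S.completionPackage K eK).arith) :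
        Set (S.completionPackage K eK).arith) := by
  rintro _ ⟨a, ha, rfl⟩
  rw [Subgroup.mem_centralizer_iff]
  intro d hd
  rw [S.geom_completionPackage_eq_topologicalClosure K eK hopen] at hd
  -- the set of elements commuting with `ι a` is closed and contains `ι(Δ^{(S)})`
  have hclosed : IsClosed {x : (S.completionPackage K eK).arith |
      x * S.completionMap a = S.completionMap a * x} :=
    isClosed_eq (continuous_id.mul continuous_const) (continuous_const.mul continuous_id)
  have hsub : ((S.DeltaX.map S.completionMap.toMonoidHom : Subgroup (S.completionPackage K eK).arith) :
      Set (S.completionPackage K eK).arith) ⊆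
      {x | x * S.completionMap a = S.completionMap a * x} := by
    rintro _ ⟨x, hx, rfl⟩
    change S.completionMap x * S.completionMap a = S.completionMap a * S.completionMap x
    rw [← map_mul, ← map_mul, (Subgroup.mem_centralizer_iff.mp (hA₀ ha)) x hx]
  have hmem : d ∈ closure (((S.DeltaX.map S.completionMap.toMonoidHom :
      Subgroup (S.completionPackage K eK).arith)) : Set (S.completionPackage K eK).arith) := by
    rw [← Subgroup.topologicalClosure_coe]
    exact hd
  exact closure_minimal hsub hclosed hmem

/-- **(H1) for `S` from a centralising subgroup and a free profinite `Δ_E`** (the «projectivity route» of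
[AbsTopI] Thm 2.6 (iv)/(v) assembled at the named completion package; the classical input (H′) is the tree's
`IsProSigmaCompletion.centralizer_eq_bot_of_normal`).  See the module docstring for the binder list.
[claim: Mochizuki2012, status: disputed] (IUTchII §1 Ex 1.8 (i), kurims p.35) [cite: MochizukiAbsTopI2012, Thm 2.6 (v) p.22] -/
theorem deltaX_characteristic_of_centralizer (p : ℕ) [Fact p.Prime] [Algebra ℚ_[p] K] [FiniteDimensional ℚ_[p] K]
    (hopen : IsOpenMap S.aug) (hΔ : IsTopologicallyFinitelyGenerated S.DeltaX)
    (hslim : IsSlimGroup (S.completionPackage K eK).gal)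
    (A₀ : Subgroup S.PiX) (hA₀ : A₀ ≤ Subgroup.centralizer ((S.DeltaX : Subgroup S.PiX) : Set S.PiX))
    (hA₀U : ∀ V : Subgroup S.Gk, IsOpen (V : Set S.Gk) → A₀.map S.aug ⊓ V ≠ ⊥)
    {n : ℕ} (hn : 2 ≤ n) (U : Subgroup (profiniteCompletion (FreeGroup (Fin n))))
    (hU : IsOpen (U : Set (profiniteCompletion (FreeGroup (Fin n)))))
    (eΔ : (S.completionPackage K eK).geom ≃ₜ* U) :
    ∀ f : S.PiX ≃ₜ* S.PiX, S.DeltaX.map f.toMulEquiv.toMonoidHom = S.DeltaX := by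
  intro f
  refine deltaX_map_eq_of_completion_compatible S (S.completionPackage K eK) S.completionMap
    S.isProfiniteCompletion_completionMap (S.galHom K eK).toMonoidHom (S.galHom_injective K eK)
    (S.completionPackage_compat K eK) (fun φ => ?_) f
  -- the binders of the route at `E = F = S.completionPackage K eK`
  have hΔE : IsTopologicallyFinitelyGenerated (S.completionPackage K eK).geom :=
    S.isTopologicallyFinitelyGenerated_geom_completionPackage K eK hopen hΔ
  -- a prime `ℓ ≠ p` and the `δ¹`-balance of the open subgroup `U ≤ F̂_n`
  obtain ⟨ℓ, hpℓ, hℓ⟩ := Nat.exists_infinite_primes (p + 1)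
  haveI : Fact ℓ.Prime := ⟨hℓ⟩
  have hℓp : ℓ ≠ (S.completionPackageBase K eK p).p := by
    change ℓ ≠ p
    omega
  have hn1 : 1 ≤ n := by omega
  have hbal : freeProlRank (S.completionPackage K eK).geom ℓ =
      @freeProlRank (S.completionPackage K eK).geom _ _ (S.completionPackageBase K eK p).p
        (S.completionPackageBase K eK p).instPrime := by
    change freeProlRank (S.completionPackage K eK).geom ℓ = freeProlRank (S.completionPackage K eK).geom p
    rw [freeProlRank_eq_of_continuousMulEquiv eΔ ℓ, freeProlRank_eq_of_continuousMulEquiv eΔ p,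
      freeProlRank_of_isOpen_profiniteCompletion_freeGroup n ℓ hn1 U hU,
      freeProlRank_of_isOpen_profiniteCompletion_freeGroup n p hn1 U hU]
  -- the centralising subgroup `A := ι(A₀)` and its density clause
  have hA := S.map_completionMap_le_centralizer_geom K eK hopen A₀ hA₀
  have hAU : ∀ V : Subgroup (S.completionPackage K eK).gal, IsOpen (V : Set (S.completionPackage K eK).gal) →
      (A₀.map S.completionMap.toMonoidHom).map (S.completionPackage K eK).aug.toMonoidHom ⊓ V ≠ ⊥ := by
    intro V hV hbot
    have hV' : IsOpen ((V.comap (S.galHom K eK).toMonoidHom : Subgroup S.Gk) : Set S.Gk) :=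
      hV.preimage eK.continuous
    apply hA₀U _ hV'
    rw [eq_bot_iff]
    rintro x ⟨⟨a, ha, rfl⟩, hxV⟩
    have hmem : (S.completionPackage K eK).aug (S.completionMap a) ∈
        (A₀.map S.completionMap.toMonoidHom).map (S.completionPackage K eK).aug.toMonoidHom ⊓ V := by
      refine ⟨⟨S.completionMap a, ⟨a, ha, rfl⟩, rfl⟩, ?_⟩
      rw [S.completionAug_completionMap K eK a]
      exact hxV
    rw [hbot, Subgroup.mem_bot, S.completionAug_completionMap K eK a] at hmem
    rw [Subgroup.mem_bot]
    exact eK.injective (by rw [map_one]; exact hmem)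
  exact FundamentalExtension.MLFBase.preservesGeom_of_centralizer_eq_bot (S.completionPackageBase K eK p)
    (S.completionPackageBase K eK p) hΔE hΔE hslim φ hℓp hbal _ hA hAU
    (FundamentalExtension.hprime_geom_of_mulEquiv_isOpen_freeProfinite _ hn U hU eΔ.toMulEquiv)

end ThetaSetting

end Literature.IUT.HodgeArakelov

end
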